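import Literature.NumberTheory.PAdicHodge.BdRPlusLogLatticeZp
import Literature.NumberTheory.PAdicHodge.TateTwistPeriodLine
import Literature.NumberTheory.PAdicHodge.BdRPeriodRingData
import HarnessLib

/-!
# `log[ũ] ≡ ℓ_u + log_p u (mod Fil^k)`: the Teichmüller logarithm of a unit of `F` versus its `B_dR⁺`-integral `ℓ_u`

Topic `Literature/NumberTheory/PAdicHodge`; namespace `Literature.NumberTheory.PAdicHodge.GaloisContinuity`. THEOREMS ONLY (no definition,
no instance, no named fact, no `sorry`). Sequel of `BdRPlusLogLatticeZp` / `BdRPlusLogLatticeKernel` (Teichmüller logarithms `log[x] mod Fil^k`, `θ∘log = log_p∘♯`, kernel `ℚ_p·t`)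
and of `BdRKummerUnitPeriod` / `TateTwistPeriodLine` (LEAD: `ℓ_u = BdRPlusTop.unitKummerLog = log([ũ]·u⁻¹) ∈ Fil¹`, `σ ℓ_u = ℓ_u + a(σ)·t`).

* §1 ★ `mem_span_xiBdR_pow_of_forall_galBdRPlus_sub_mem` — **`H⁰(Γ_F, ker θ / Fil^k) = 0`**: an element `b ∈ B_dR⁺` with `θ(b) = 0` and
  `σ b − b ∈ ξ^k B_dR⁺` for all `σ` lies in `ξ^k B_dR⁺` (induction on `k`: `Fil^j/Fil^{j+1} ≅ ℂ_F(j)` via the uniformizer `u_dR = [ε] − 1` with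
  `σ u = k_σ u`, `θ(k_σ) = χ(σ)`, and Tate's `ℂ_F(χ^j)^{Γ_F} = 0`, `CompletedAlgClosure.eq_zero_of_forall_smul_eq_cyclotomicCharacter_zpow`).
* §2 ★★ `IsLogModFil.sub_unitKummerLog_sub_embBdRHom_unitLog_mem` — for a unit `u ∈ F` with `u ≡ 1 (mod p)` (`ũ₀ = 1` for the root system
  `ũ = rootTilt u`) and any Teichmüller logarithm `L` of `[ũ]` modulo `Fil^k` (`k ≥ 1`):
  **`L − (ℓ_u + ι_F(log_p u)) ∈ ξ^k B_dR⁺`** — both sides have `θ = ι_F(log_p u)` (`IsLogModFil.thetaBdR_eq_algebraMap_unitLog`) and the same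
  transformation law `σ(·) = · + a(σ)·t` (`gal_kummerUnitLog_eq` / `isLogModFil_teichmuller_epsPow` + uniqueness), so §1 applies to the difference.

Consequence for line `kato_lever` of crux K★ `stmt-BirchSwinnertonDyer-22226` ((H4) step (3), memo `Lines/kato-lever-K3-H4-log.md` §3): in the
socket `tatePairingPoint_eq_neg_trace_of_recognition` (p729757) the model term `ψ(τ)·ℓ_u` may be replaced by `ψ(τ)·L_ũ − ψ(τ)·ι_F(log_p u)` with
`L_ũ ∈ X⁰_k` a TEICHMÜLLER LOGARITHM (`IsTeichLog`) and `τ ↦ ψ(τ)·ι_F(log_p u)` a cocycle: the recognition identity is a statement about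
`X₂`-valued cochains. Infrastructure only; BSD / K★ are not proved by any of this.

## References
* J. Tate, *p-divisible groups* (1967), §3.3 Thm. 2. [Tate1967]
* J.-M. Fontaine, *Le corps des périodes p-adiques*, Astérisque 223 (1994), Exp. II §1.5.4–1.5.5. [FontaineAsterisque223III]
* S. Bloch, K. Kato, *L-functions and Tamagawa numbers of motives* (1990), Ex. 3.10.1. [BlochKato1990]
-/

noncomputable section

namespace Literature.NumberTheory.PAdicHodge

namespace GaloisContinuity

open ValuativeRel Field Ideal WittVector
open Literature.NumberTheory.GaloisRepresentations Literature.NumberTheory.GaloisRepresentations.IsNonarchimedeanLocalField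
open Literature.IUT.LogVolume

variable {F : Type} [Field F] [ValuativeRel F] [TopologicalSpace F] [IsNonarchimedeanLocalField F]
  [CharZero F] {p : ℕ} [Fact p.Prime] [Fact (¬ IsUnit (p : integerC F))]
  [IsAdicComplete (Ideal.span {(p : integerC F)}) (integerC F)]

/-! ## §1 `H⁰(Γ_F, Fil¹ B_dR⁺ / Fil^k) = 0` -/

/-- ★ **`H⁰(Γ_F, ker θ / Fil^k B_dR⁺) = 0`.** If `b ∈ B_dR⁺(F)` has `θ(b) = 0` and `σ(b) − b ∈ ξ^k B_dR⁺` for every `σ ∈ Γ_F`, then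
`b ∈ ξ^k B_dR⁺`: the graded pieces `Fil^j/Fil^{j+1} ≅ ℂ_F(j)`, `j ≥ 1`, have no `Γ_F`-invariants (Tate).
[cite: Tate1967, §3.3 Theorem 2] [cite: FontaineAsterisque223III, Exp. II §1.5.5] -/
theorem mem_span_xiBdR_pow_of_forall_galBdRPlus_sub_mem (hp : valuation F p < 1)
    (hF : Function.Surjective (fontaineTheta (integerC F) p)) {b : BDeRhamPlus (integerC F) p} (h0 : thetaBdR b = 0) :
    ∀ k : ℕ, (∀ σ : absoluteGaloisGroup F, galBdRPlus σ b - b ∈ Ideal.span {(xiBdR : BDeRhamPlus (integerC F) p) ^ k}) →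
      b ∈ Ideal.span {(xiBdR : BDeRhamPlus (integerC F) p) ^ k} := by
  haveI := isDomain_bDeRhamPlus (F := F) (p := p) hF
  obtain ⟨v, hv, huv⟩ := exists_uBdR_eq_xiBdR_mul (F := F) (p := p) hF
  have hxi : (xiBdR : BDeRhamPlus (integerC F) p) ≠ 0 := fun h =>
    one_ne_zero (eq_zero_of_xiBdR_mul_eq_zero (F := F) (p := p) (x := 1) (by rw [h, zero_mul]))
  have hu0 : (uBdR : BDeRhamPlus (integerC F) p) ≠ 0 := by rw [huv]; exact mul_ne_zero hxi hv.ne_zero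
  have hspan : ∀ k : ℕ, Ideal.span {(xiBdR : BDeRhamPlus (integerC F) p) ^ k} = Ideal.span {uBdR ^ k} := fun k => by
    rw [huv, mul_pow, Ideal.span_singleton_mul_right_unit (hv.pow k)]
  intro k
  induction k with
  | zero => intro; rw [pow_zero, Ideal.span_singleton_one]; exact Submodule.mem_top
  | succ k ih =>
    intro hgal
    have hb : b ∈ Ideal.span {(xiBdR : BDeRhamPlus (integerC F) p) ^ k} :=
      ih fun σ => Ideal.span_singleton_le_span_singleton.2 (pow_dvd_pow _ (Nat.le_succ k)) (hgal σ)
    rw [hspan] at hb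
    obtain ⟨c, hc⟩ := Ideal.mem_span_singleton'.1 hb
    -- `θ(c) = 0`
    have hθc : thetaBdR c = 0 := by
      rcases Nat.eq_zero_or_pos k with hk | hk
      · subst hk; rw [pow_zero, mul_one] at hc; rw [hc]; exact h0
      · refine CompletedAlgClosure.eq_zero_of_forall_smul_eq_cyclotomicCharacter_zpow hp (j := -(k : ℤ)) (by omega) fun σ => ?_
        obtain ⟨kσ, hkσ, hθk⟩ := exists_galBdRPlus_uBdR_eq_mul_cyclotomic hp hF σ
        -- `σ b − b = u^k (kσ^k σc − c) ∈ (u^{k+1})`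
        have h1 := hgal σ
        rw [hspan, Ideal.mem_span_singleton'] at h1
        obtain ⟨d, hd⟩ := h1
        have h2 : uBdR ^ k * (kσ ^ k * galBdRPlus σ c - c - uBdR * d) = 0 := by
          have e : galBdRPlus σ b - b = uBdR ^ k * (kσ ^ k * galBdRPlus σ c - c) := by
            rw [← hc, map_mul, map_pow, hkσ]; ring
          rw [mul_sub, ← e, ← hd]; ring
        have h3 : kσ ^ k * galBdRPlus σ c - c = uBdR * d := by
          have := (mul_eq_zero.1 h2).resolve_left (pow_ne_zero k hu0)
          rwa [sub_eq_zero] at this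
        -- apply `θ`: `χ(σ)^k · σ(θ c) = θ c`
        have h4 := congrArg thetaBdR h3
        rw [map_sub, map_mul, map_pow, thetaBdR_galBdRPlus, hθk, map_mul, show thetaBdR (uBdR : BDeRhamPlus (integerC F) p) = 0 by
          rw [huv, map_mul, thetaBdR_xiBdR, zero_mul], zero_mul, sub_eq_zero] at h4
        set cσ : CompletedAlgClosure F := algebraMap F (CompletedAlgClosure F)
          (LocalField.padicRingHom F p hp (((GaloisRep.cyclotomicCharacter F p σ : ℤ_[p]ˣ) : ℤ_[p]) : ℚ_[p])) with hcσ
        have hc0 : cσ ≠ 0 := by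
          rw [hcσ, map_ne_zero_iff _ (algebraMap F (CompletedAlgClosure F)).injective,
            map_ne_zero_iff _ (LocalField.padicRingHom F p hp).injective]
          exact PadicInt.coe_ne_zero.2 (GaloisRep.cyclotomicCharacter F p σ).ne_zero
        rw [zpow_neg, zpow_natCast, eq_inv_mul_iff_mul_eq₀ (pow_ne_zero k hc0)]
        exact h4
    -- hence `c ∈ (ξ) = (u)` and `b ∈ (u^{k+1})`
    rw [mem_ker_thetaBdR_iff, show Ideal.span {(xiBdR : BDeRhamPlus (integerC F) p)} = Ideal.span {uBdR ^ 1} by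
      rw [← hspan 1, pow_one], pow_one] at hθc
    obtain ⟨e, he⟩ := Ideal.mem_span_singleton'.1 hθc
    rw [hspan]
    exact Ideal.mem_span_singleton'.2 ⟨e, by rw [← hc, ← he]; ring⟩

/-! ## §2 The Teichmüller logarithm of a unit of `F` -/

omit [Fact (¬ IsUnit (p : integerC F))] [IsAdicComplete (Ideal.span {(p : integerC F)}) (integerC F)] [Fact p.Prime] [CharZero F] in
/-- `u ≠ 0 ⟹ u ≠ 0` in `F̄`. [folklore] -/
private theorem algebraMap_normedAlgClosure_ne_zero_aux {u : F} (hu : u ≠ 0) : algebraMap F (NormedAlgClosure F) u ≠ 0 :=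
  (map_ne_zero_iff _ (algebraMap F (NormedAlgClosure F)).injective).2 hu

/-- ★★ **`log[ũ] ≡ ℓ_u + ι_F(log_p u) (mod Fil^k)`.** Let `u ∈ F` be a unit with `ũ₀ = 1` for its root system `ũ = rootTilt u` (i.e.
`u ≡ 1 (mod p)`), `k ≥ 1`, and `L` a Teichmüller logarithm of `[ũ]` modulo `Fil^k` (`IsLogModFil k ([ũ] − 1) L`). Then
`L − (ℓ_u + ι_F(log_p u)) ∈ ξ^k B_dR⁺`, where `ℓ_u = BdRPlusTop.unitKummerLog` is the LEAD's `B_dR⁺`-integral `log([ũ]·u⁻¹)` of the Kummer cocycle,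
`ι_F = embBdRHom` and `log_p = unitLog` of `PadicField.normedField`. (Both have `θ = ι(log_p u)` and `σ(·) − · = a(σ)·t`; §1.)
[cite: FontaineAsterisque223III, Exp. II §1.5.4] [cite: BlochKato1990, Ex. 3.10.1] -/
theorem IsLogModFil.sub_unitKummerLog_sub_embBdRHom_unitLog_mem (hp : valuation F p < 1)
    (hF : Function.Surjective (fontaineTheta (integerC F) p)) {u : F} (hu : u ≠ 0)
    (hu1 : ‖algebraMap F (NormedAlgClosure F) u‖ ≤ 1)
    (hx0 : PreTilt.coeff 0 (BdRPlusTop.rootTilt p (algebraMap F (NormedAlgClosure F) u) hu1) = 1) {k : ℕ} (hk : 1 ≤ k)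
    {L : BDeRhamPlus (integerC F) p}
    (hL : IsLogModFil k ((teichmuller p (BdRPlusTop.rootTilt p (algebraMap F (NormedAlgClosure F) u) hu1) : Ainf (p := p) F) - 1) L) :
    L - ((BdRPlusTop.of F p).symm (BdRPlusTop.unitKummerLog hp hF hu hu1) +
        embBdRHom hp hF (letI := PadicField.normedField F p hp; unitLog u)) ∈
      Ideal.span {(xiBdR : BDeRhamPlus (integerC F) p) ^ k} := by
  set ũ := BdRPlusTop.rootTilt p (algebraMap F (NormedAlgClosure F) u) hu1 with hũ
  set ℓ : BDeRhamPlus (integerC F) p := (BdRPlusTop.of F p).symm (BdRPlusTop.unitKummerLog hp hF hu hu1) with hℓ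
  have hyI := (teichmuller_sub_one_mem_span_p_xi_iff_coeff_zero ũ).2 hx0
  refine mem_span_xiBdR_pow_of_forall_galBdRPlus_sub_mem hp hF ?_ k fun σ => ?_
  · -- `θ` vanishes: `θ L = ι(log_p u) = θ(ℓ_u) + θ(ι_F(log_p u))`
    have hθL : thetaBdR L = algebraMap F (CompletedAlgClosure F) (letI := PadicField.normedField F p hp; unitLog u) := by
      refine hL.thetaBdR_eq_algebraMap_unitLog hp hk hyI ?_
      rw [add_sub_cancel, thetaBdR_ainfToBdR_teichmuller, hũ, BdRPlusTop.coe_untilt_rootTilt, CompletedAlgClosure.algebraMap_eq_coe]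
    have hθℓ : thetaBdR ℓ = 0 := by
      rw [mem_ker_thetaBdR_iff, hℓ, ← BdRPlusTop.mem_filOne_iff]
      exact BdRPlusTop.kummerUnitLog_mem_filOne hp hF ũ (algebraMap F (NormedAlgClosure F) u)
        (algebraMap_normedAlgClosure_ne_zero_aux hu) (BdRPlusTop.coe_untilt_rootTilt _ hu1)
    rw [map_sub, map_add, hθL, hθℓ, zero_add, thetaBdR_embBdRHom, sub_self]
  · -- the transformation laws agree: `σ L − L ≡ a(σ)·t ≡ σ ℓ_u − ℓ_u`, `σ ι_F = ι_F`
    have hσu : σ • algebraMap F (NormedAlgClosure F) u = algebraMap F (NormedAlgClosure F) u := NormedAlgClosure.smul_algebraMap σ u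
    set a : ℤ_[p] := BdRPlusTop.kummerExp (p := p) σ (algebraMap_normedAlgClosure_ne_zero_aux hu) hσu with ha
    -- `σ L` and `a·t + L` are both logarithms of `[ε^a ũ] = [σ♭ ũ]`
    have h1 : IsLogModFil k ((teichmuller p (galTilt σ ũ) : Ainf (p := p) F) - 1) (PAdicHodge.galBdRPlus σ L) := by
      have h := hL.galBdRPlus σ
      rwa [map_sub, map_one, galAinf_teichmuller] at h
    have h2 : IsLogModFil k ((teichmuller p (galTilt σ ũ) : Ainf (p := p) F) - 1) (qpToBdR (a : ℚ_[p]) * tBdR + L) := by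
      rw [hũ, BdRPlusTop.galTilt_rootTilt σ (algebraMap_normedAlgClosure_ne_zero_aux hu) hu1 hσu, ← ha, ← hũ]
      have hε : PreTilt.coeff 0 (epsPow a : PreTilt (integerC F) p) = 1 := by
        rw [PreTilt.epsPow_eq_tiltPow]; exact PreTilt.coeff_zero_tiltPow _ _
      exact (isLogModFil_teichmuller_epsPow k a).teichmuller_mul hε hx0 hL
    have hLgal : PAdicHodge.galBdRPlus σ L - L - qpToBdR (a : ℚ_[p]) * tBdR ∈ Ideal.span {(xiBdR : BDeRhamPlus (integerC F) p) ^ k} := by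
      have h := h1.sub_mem_span_xiBdR_pow h2
      rwa [show PAdicHodge.galBdRPlus σ L - (qpToBdR (a : ℚ_[p]) * tBdR + L) = PAdicHodge.galBdRPlus σ L - L - qpToBdR (a : ℚ_[p]) * tBdR by ring] at h
    -- `σ ℓ_u = ℓ_u + a·t`
    have hℓgal : PAdicHodge.galBdRPlus σ ℓ = ℓ + qpToBdR (a : ℚ_[p]) * tBdR := by
      have h := BdRPlusTop.gal_kummerUnitLog_eq hp hF σ (algebraMap_normedAlgClosure_ne_zero_aux hu) hu1 hσu
      apply (BdRPlusTop.of F p).injective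
      rw [← BdRPlusTop.gal_of, map_add, hℓ, RingEquiv.apply_symm_apply]
      exact h
    have e : PAdicHodge.galBdRPlus σ (L - (ℓ + embBdRHom hp hF (letI := PadicField.normedField F p hp; unitLog u))) -
        (L - (ℓ + embBdRHom hp hF (letI := PadicField.normedField F p hp; unitLog u))) =
        PAdicHodge.galBdRPlus σ L - L - qpToBdR (a : ℚ_[p]) * tBdR := by
      rw [map_sub, map_add, hℓgal, galBdRPlus_embBdRHom]; ring
    rw [e]
    exact hLgal

end GaloisContinuity

end Literature.NumberTheory.PAdicHodge

end
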